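import Summits.Ventures.CertifiedManyBodySolver.Theorems.CovHg1201M19P10SlantParts
import Summits.Ventures.CertifiedManyBodySolver.Downfold.BoxesHg1201EKinematicCoverTp2
import Summits.Ventures.CertifiedManyBodySolver.Downfold.BoxesHg1201ESlantCut2Slots
import HarnessLib

/-!
# Theorems/CovHg1201M19P10Slant2Parts.lean — route «CovHg1201M19P10» (Hg-1201 @ 10 GPa): under the captain's FALLBACK RUNG («TP-KINCUT-2», `t′ = −241/500`) the certificate part of
# BOTH cruxes is the FALLBACK TRIANGLE `{σ ∈ [−49/100, −241/500], n ∈ [43/50, 22/25], n ≥ 43/50 + (5/2)(σ + 49/100)}` — `4/5` of today's triangle, `1/140` of the P10 face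

Supports stmt-Ventures-27105 «PatchBottomP10» (and stmt-Ventures-27104 «PatchLeftEdgeP10»). INSURANCE for the @10 read ladder (captain hubbard-cov-hg1201-plan-1 RULING hubbard-obs
STATUS l.2966). Ingredients: this seat's `covHg1201M19P10_Patch…P10_of_outerTriangle` (`Theorems/CovHg1201M19P10SlantParts.lean`, p632692), hubbard-cov-hg1201-box-2 g1's
inner-slot-2 word `hg1201M19P10_innerSlot2_orbitMean_ge_negBar` (`Downfold/BoxesHg1201EKinematicCoverTp2.lean`: slots `σ ∈ [−241/500, −47/100]` state-free at every `n ≤ 22/25`) and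
this seat's words under the steeper SLANT-2 chord (`Downfold/BoxesHg1201ESlantCut2Slots.lean`).
* `covHg1201M19P10_PatchBottomP10_of_fallbackTriangle2` / `covHg1201M19P10_PatchLeftEdgeP10_of_fallbackTriangle2`: (item restricted to the FALLBACK TRIANGLE) → item; both at once.
HONEST FRAMING: set algebra + one-body kinematics + the torus-limit variational inequality; zero solve, no claim node, no definition; CONDITIONAL on the fallback triangle; certified
stiffness-scale CEILINGS on a downfolded screening-grade PRESSURE box = CONTROL / CALIBRATION + labelled heuristic (xx1; content = below `0.98 ×` the kinematic MAJORANT, no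
suppression below free claimed; no `dT_c/dP` sentence); a ceiling never speaks to the presence of superconductivity; NO item, stub or rung leaf is closed by this file; no summit
statement is proved. Seat hubbard-cov-hg1201-unc-2 g3 (`prover-hubbard-cov-hg1201-unc-2-g2-0`), cell `pub/hubbard-downfold`.
-/

noncomputable section

namespace Summit.Ventures.CertifiedManyBodySolver.Theorems

open Set Filter Topology
open Summit.Ventures.CertifiedManyBodySolver.Theses.CovHg1201M19P10
open Summit.Ventures.CertifiedManyBodySolver.Observables
open Summit.Ventures.CertifiedManyBodySolver.Downfold
open Summit.Ventures.CertifiedManyBodySolver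
open Literature.MathematicalPhysics.QuantumLattice Literature.MathematicalPhysics.QuantumLattice.ThermodynamicLimit
open Literature.Probability.LatticeModels
open Matrix HubbardWave0
open scoped BigOperators ComplexOrder

/-- **«PatchBottomP10» (stmt-Ventures-27105) from its FALLBACK TRIANGLE**: the item restricted to slots `σ ∈ [−49/100, −241/500]` (sources `s ∈ [−49/100, σ]`) and densities
`n ∈ [43/50, 22/25]` with `n ≥ 43/50 + (5/2)(σ + 49/100)` implies the item — today's triangle (p632692), box-2's inner-slot-2 word for `σ ≥ −241/500`, and the trapezoid
under the SLANT-2 chord are state-free. CONDITIONAL on the fallback triangle. [cite: ScalapinoWhiteZhang1993, §II] [cite: LiebLoss1993, §8, Theorem 8.2] -/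
theorem covHg1201M19P10_PatchBottomP10_of_fallbackTriangle2
    (h : ∀ n ∈ Set.Icc (43 / 50 : ℝ) (22 / 25), ∀ σ ∈ Set.Icc (-49 / 100 : ℝ) (-241 / 500), 43 / 50 + 5 / 2 * (σ + 49 / 100) ≤ n →
      ∀ s ∈ Set.Icc (-49 / 100 : ℝ) σ,
      ∀ (ω : InfVolFermionState 2) (Ls : ℕ → ℕ) (ψ : ∀ L, Fock (Orb (FermionTorus 2 L))),
      Tendsto Ls atTop atTop →
      (∀ j, IsGroundStateInSector (hubbardTorusTT' (Ls j) 1 s 3) (rectN n (Ls j)) 0 (ψ (Ls j))) →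
      (∀ j, star (ψ (Ls j)) ⬝ᵥ ψ (Ls j) = 1) → ω.IsTorusLimitOf ψ Ls →
      -(4767609 / 10000000 : ℝ) ≤ ((Finset.univ : Finset (DihedralGroup 4)).card : ℝ)⁻¹ * ∑ g ∈ (Finset.univ : Finset (DihedralGroup 4)),
        (ω.expect (d4ShiftSet g 0 (Literature.Probability.LatticeModels.box 2 7))
          (fermionEmbed (PolySite.d4Emb g 0 (Literature.Probability.LatticeModels.box 2 7)) (-oddMomentObsTT σ 3 0))).re) :
    PatchBottomP10 := by
  refine covHg1201M19P10_PatchBottomP10_of_outerTriangle (fun n hn σ hσ _ s hs ω Ls ψ hLs hψ h1 hω => ?_)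
  rcases le_or_gt σ (-241 / 500) with hσ2 | hσ2
  · rcases le_or_gt n (43 / 50 + 5 / 2 * (σ + 49 / 100)) with hle | hgt
    · exact hg1201M19P10_patchBottomP10_slant2Slots_kinematic n ⟨le_trans (by norm_num) hn.1, hn.2⟩ σ ⟨hσ.1, hσ2⟩ hle s hs ω Ls ψ hLs hψ h1 hω
    · exact h n hn σ ⟨hσ.1, hσ2⟩ hgt.le s hs ω Ls ψ hLs hψ h1 hω
  · exact hg1201M19P10_innerSlot2_orbitMean_ge_negBar σ 3 s 3 ⟨hσ2.le, by linarith [hσ.2]⟩ (by linarith [hn.1]) hn.2 ω Ls ψ hLs hψ h1 hω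

/-- **«PatchLeftEdgeP10» (stmt-Ventures-27104) from its FALLBACK TRIANGLE**: the item restricted to `σ ∈ [−49/100, −241/500]`, `n ∈ [43/50, 22/25]`,
`n ≥ 43/50 + (5/2)(σ + 49/100)` (states at `(−49/100, U′, n)`, `U′ ∈ [3, 17/2]`) implies the item. CONDITIONAL on the fallback triangle.
[cite: ScalapinoWhiteZhang1993, §II] [cite: LiebLoss1993, §8, Theorem 8.2] -/
theorem covHg1201M19P10_PatchLeftEdgeP10_of_fallbackTriangle2
    (h : ∀ n ∈ Set.Icc (43 / 50 : ℝ) (22 / 25), ∀ σ ∈ Set.Icc (-49 / 100 : ℝ) (-241 / 500), 43 / 50 + 5 / 2 * (σ + 49 / 100) ≤ n →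
      ∀ U' ∈ Set.Icc (3 : ℝ) (17 / 2),
      ∀ (ω : InfVolFermionState 2) (Ls : ℕ → ℕ) (ψ : ∀ L, Fock (Orb (FermionTorus 2 L))),
      Tendsto Ls atTop atTop →
      (∀ j, IsGroundStateInSector (hubbardTorusTT' (Ls j) 1 (-49 / 100) U') (rectN n (Ls j)) 0 (ψ (Ls j))) →
      (∀ j, star (ψ (Ls j)) ⬝ᵥ ψ (Ls j) = 1) → ω.IsTorusLimitOf ψ Ls →
      -(4767609 / 10000000 : ℝ) ≤ ((Finset.univ : Finset (DihedralGroup 4)).card : ℝ)⁻¹ * ∑ g ∈ (Finset.univ : Finset (DihedralGroup 4)),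
        (ω.expect (d4ShiftSet g 0 (Literature.Probability.LatticeModels.box 2 7))
          (fermionEmbed (PolySite.d4Emb g 0 (Literature.Probability.LatticeModels.box 2 7)) (-oddMomentObsTT σ U' 0))).re) :
    PatchLeftEdgeP10 := by
  refine covHg1201M19P10_PatchLeftEdgeP10_of_outerTriangle (fun n hn σ hσ _ U' hU' ω Ls ψ hLs hψ h1 hω => ?_)
  rcases le_or_gt σ (-241 / 500) with hσ2 | hσ2
  · rcases le_or_gt n (43 / 50 + 5 / 2 * (σ + 49 / 100)) with hle | hgt
    · exact hg1201M19P10_patchLeftEdgeP10_slant2Slots_kinematic n ⟨le_trans (by norm_num) hn.1, hn.2⟩ σ ⟨hσ.1, hσ2⟩ hle U' hU' ω Ls ψ hLs hψ h1 hω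
    · exact h n hn σ ⟨hσ.1, hσ2⟩ hgt.le U' hU' ω Ls ψ hLs hψ h1 hω
  · exact hg1201M19P10_innerSlot2_orbitMean_ge_negBar σ U' (-49 / 100) U' ⟨hσ2.le, by linarith [hσ.2]⟩ (by linarith [hn.1]) hn.2 ω Ls ψ hLs hψ h1 hω

/-- **Both cruxes of «CovHg1201M19P10» from their FALLBACK TRIANGLES at once** (`1/140` of the typed P10 face each). [cite: ScalapinoWhiteZhang1993, §II] -/
theorem covHg1201M19P10_cruxes_of_fallbackTriangles2
    (hB : ∀ n ∈ Set.Icc (43 / 50 : ℝ) (22 / 25), ∀ σ ∈ Set.Icc (-49 / 100 : ℝ) (-241 / 500), 43 / 50 + 5 / 2 * (σ + 49 / 100) ≤ n →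
      ∀ s ∈ Set.Icc (-49 / 100 : ℝ) σ,
      ∀ (ω : InfVolFermionState 2) (Ls : ℕ → ℕ) (ψ : ∀ L, Fock (Orb (FermionTorus 2 L))),
      Tendsto Ls atTop atTop →
      (∀ j, IsGroundStateInSector (hubbardTorusTT' (Ls j) 1 s 3) (rectN n (Ls j)) 0 (ψ (Ls j))) →
      (∀ j, star (ψ (Ls j)) ⬝ᵥ ψ (Ls j) = 1) → ω.IsTorusLimitOf ψ Ls →
      -(4767609 / 10000000 : ℝ) ≤ ((Finset.univ : Finset (DihedralGroup 4)).card : ℝ)⁻¹ * ∑ g ∈ (Finset.univ : Finset (DihedralGroup 4)),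
        (ω.expect (d4ShiftSet g 0 (Literature.Probability.LatticeModels.box 2 7))
          (fermionEmbed (PolySite.d4Emb g 0 (Literature.Probability.LatticeModels.box 2 7)) (-oddMomentObsTT σ 3 0))).re)
    (hL : ∀ n ∈ Set.Icc (43 / 50 : ℝ) (22 / 25), ∀ σ ∈ Set.Icc (-49 / 100 : ℝ) (-241 / 500), 43 / 50 + 5 / 2 * (σ + 49 / 100) ≤ n →
      ∀ U' ∈ Set.Icc (3 : ℝ) (17 / 2),
      ∀ (ω : InfVolFermionState 2) (Ls : ℕ → ℕ) (ψ : ∀ L, Fock (Orb (FermionTorus 2 L))),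
      Tendsto Ls atTop atTop →
      (∀ j, IsGroundStateInSector (hubbardTorusTT' (Ls j) 1 (-49 / 100) U') (rectN n (Ls j)) 0 (ψ (Ls j))) →
      (∀ j, star (ψ (Ls j)) ⬝ᵥ ψ (Ls j) = 1) → ω.IsTorusLimitOf ψ Ls →
      -(4767609 / 10000000 : ℝ) ≤ ((Finset.univ : Finset (DihedralGroup 4)).card : ℝ)⁻¹ * ∑ g ∈ (Finset.univ : Finset (DihedralGroup 4)),
        (ω.expect (d4ShiftSet g 0 (Literature.Probability.LatticeModels.box 2 7))
          (fermionEmbed (PolySite.d4Emb g 0 (Literature.Probability.LatticeModels.box 2 7)) (-oddMomentObsTT σ U' 0))).re) :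
    PatchBottomP10 ∧ PatchLeftEdgeP10 :=
  ⟨covHg1201M19P10_PatchBottomP10_of_fallbackTriangle2 hB, covHg1201M19P10_PatchLeftEdgeP10_of_fallbackTriangle2 hL⟩

end Summit.Ventures.CertifiedManyBodySolver.Theorems

end
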